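import Literature.Geometry.Riemannian.HamiltonPCOPinchingOne
import Literature.Geometry.Riemannian.PinchingEstimatesLargest
import Literature.Geometry.Riemannian.PinchingSetsConvexity
import HarnessLib

/-!
# Hamilton 1986, Thm. 7.1, inequality (2): `a₃ ≤ H a₁`, `c₃ ≤ H c₁` are preserved — proved
(topic `Geometry/Riemannian`)

Second brick of the pinching set of **Hamilton 1986, Thm. 7.1** (J. Differential Geom. 24,
p. 170; the ODE layer of `Literature.Geometry.Riemannian.hamilton_positiveCurvatureOperator_classification_four`,
see `HamiltonPCOClassificationProofs.lean` and `HamiltonPCOPinchingOne.lean` for inequality (1)).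
Hamilton, pp. 171–172: from Lemma 7.2, `d/dt log a₁ ≥ a₁ + 2a₃` and
`d/dt log a₃ ≤ a₃ + 2a₁ + b₃²/a₃`; "Then `b₃² ≤ G a₁c₁`. Since `tr A = tr C`, [`c₁ ≤ c = a ≤ 3a₃`]
which shows `b₃²/a₃ ≤ 3G a₁`. Then `d/dt log (a₃/a₁) ≤ (3G + 1)a₁ - a₃`, so if `H > 3G + 2` … the
inequalities `a₃ ≤ H a₁` and likewise `c₃ ≤ H c₁` are preserved."

PROVED here at the ODE level (`HamiltonODE.IsInvariantRel`, `HamiltonCurvatureODE.lean`), with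
`{a₃ ≤ H a₁}` in the tree's closed variational form `Matrix.LargestLESmallestAdd A H 0`
(`uᵀAu ≤ H wᵀAw` for all unit `u, w`; `PinchingEstimatesODE.lean`):

* `hamilton1986_pinchingTwo_ode` — for `0 < m`, `0 < G` and `G + 1 ≤ H`, the set
  `{a₃ ≤ H a₁} ∩ {c₃ ≤ H c₁}` is forward invariant under Hamilton's ODE relative to
  `{A, C symmetric} ∩ {tr A = tr C} ∩ {a₁ ≥ m} ∩ {c₁ ≥ m} ∩ {(b₂ + b₃)² ≤ G a₁ c₁}` — exactly the
  data the printed argument uses ("the sets defined by each successive group of inequalities is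
  preserved", p. 171: (2) is proved on the set where (1) holds; `tr A = tr C` is preserved,
  `isInvariant_trace_eq`; `a₁, c₁ ≥ m > 0` on `M ≥ m`). The threshold: the bookkeeping below uses
  `c₁ ≤ c/3 = a/3 ≤ a₃` (the minimum of the Rayleigh quotient is at most a diagonal entry) where
  the paper uses `c₁ ≤ c ≤ 3a₃`, so every `H ≥ G + 1` works; Hamilton's `H > 3G + 2` is covered.
* `hamilton1986_pinchingTwo_ode_of_operatorGE` — the same relative to
  `{A, C symmetric} ∩ {tr A = tr C} ∩ {M ≥ m} ∩ {(1)}`.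

Proof: the barrier lemma `minOverSet_nonneg_of_deriv` (`HamiltonODEMinBarrier.lean`) for
Hamilton's 1997 functional `largestG H 0 A (u, w) = H wᵀAw - uᵀAu` over `unitSet²`
(`PinchingEstimatesLargestCore.lean`): at a minimiser with `-1 < 𝒢 ≤ 0`, `w` minimises (`a₁ = x`)
and `u` maximises (`a₃ = y > x`) the Rayleigh quotient, they are orthogonal eigenvectors, and in
the eigenbasis `(w, n, u)` Lemma 6.1 reads `wᵀA'w = x² + |ᵗBw|² + 2a₂y ≥ x² + 2xy`,
`uᵀA'u = y² + |ᵗBu|² + 2xa₂ ≤ y² + Gxy + 2xy` (`|ᵗBu|² ≤ b₃² ≤ (b₂ + b₃)² ≤ G a₁c₁ ≤ G x y`),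
whence `𝒢' ≥ Hx²(H - G - 1) - ε² - (G + 2)xε ≥ -(1 + (G + 2)R) ε = C · 𝒢` for
`ε = y - Hx ∈ [0, 1)` and `R ≥ Σ|A|` (`pcoTwo_scalar`). No new named facts (D-0026).

## References

* R. S. Hamilton, *Four-manifolds with positive curvature operator*, J. Differential Geom. 24
  (1986) 153–179: §6, Lemma 6.1 (p. 167), §7, Thm. 7.1 (p. 170), Lemma 7.2 and the proof of (2)
  (pp. 171–172). [Hamilton1986]
* R. S. Hamilton, Comm. Anal. Geom. 5 (1997), §2.1, Thm. 1.7 (pp. 10–11) (the analogous estimate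
  `a₃ ≤ Ψ(a₁ + ρ)`; its functional and eigenbasis lemmas are reused). [Hamilton1997]
-/

noncomputable section

open Set Real Filter
open scoped Matrix BigOperators Topology

namespace Literature.Geometry.Riemannian

namespace HamiltonODE

/-! ### Consequences of inequality (1) and of `tr A = tr C` -/

/-- The minimum of the Rayleigh quotient is at most a third of the trace: some standard basis
vector `z` has `zᵀMz = Mᵢᵢ ≤ tr M / 3`. [folklore] -/
theorem exists_unit_rayleigh_le_trace_div_three (M : Matrix (Fin 3) (Fin 3) ℝ) :
    ∃ z : Fin 3 → ℝ, z ⬝ᵥ z = 1 ∧ z ⬝ᵥ (M *ᵥ z) ≤ M.trace / 3 := by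
  have h0 : (![1, 0, 0] : Fin 3 → ℝ) ⬝ᵥ (M *ᵥ ![1, 0, 0]) = M 0 0 := by
    simp [Matrix.mulVec, dotProduct, Fin.sum_univ_three]
  have h1 : (![0, 1, 0] : Fin 3 → ℝ) ⬝ᵥ (M *ᵥ ![0, 1, 0]) = M 1 1 := by
    simp [Matrix.mulVec, dotProduct, Fin.sum_univ_three]
  have h2 : (![0, 0, 1] : Fin 3 → ℝ) ⬝ᵥ (M *ᵥ ![0, 0, 1]) = M 2 2 := by
    simp [Matrix.mulVec, dotProduct, Fin.sum_univ_three]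
  have htr : M.trace = M 0 0 + M 1 1 + M 2 2 := Matrix.trace_fin_three M
  by_cases c0 : M 0 0 ≤ M.trace / 3
  · exact ⟨![1, 0, 0], by simp [dotProduct, Fin.sum_univ_three], by rw [h0]; exact c0⟩
  by_cases c1 : M 1 1 ≤ M.trace / 3
  · exact ⟨![0, 1, 0], by simp [dotProduct, Fin.sum_univ_three], by rw [h1]; exact c1⟩
  refine ⟨![0, 0, 1], by simp [dotProduct, Fin.sum_univ_three], ?_⟩
  rw [h2]
  rw [not_le] at c0 c1
  linarith

/-- **`b₃² ≤ (b₂ + b₃)² ≤ G a₁ c₁`, variationally**: under inequality (1), `(uᵀBv)² ≤ G (wᵀAw)(zᵀCz)`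
for all unit `u, v, w, z` (complete `u`, `v` to orthonormal pairs `(u, u₂)`, `(v, ±v₂)` and add
the two instances of (1): `(s + t)² + (s - t)² = 2s² + 2t²`). [cite: Hamilton1986, §7, p. 171 ("Then `b₃² ≤ G a₁c₁`")] -/
theorem SingularValuesSumSqLEMinProd.sq_bilin_le {p : Blocks} {G : ℝ}
    (h : SingularValuesSumSqLEMinProd p G) {u v w z : Fin 3 → ℝ} (hu : u ⬝ᵥ u = 1)
    (hv : v ⬝ᵥ v = 1) (hw : w ⬝ᵥ w = 1) (hz : z ⬝ᵥ z = 1) :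
    (u ⬝ᵥ (p.2.1 *ᵥ v)) ^ 2 ≤ G * (w ⬝ᵥ (p.1 *ᵥ w)) * (z ⬝ᵥ (p.2.2 *ᵥ z)) := by
  obtain ⟨u₂, -, hu₂, -, huu₂, -, -⟩ := exists_orthonormal_complement hu
  obtain ⟨v₂, -, hv₂, -, hvv₂, -, -⟩ := exists_orthonormal_complement hv
  have hp := h u u₂ v v₂ w z hu hu₂ huu₂ hv hv₂ hvv₂ hw hz
  have hn := h u u₂ v (-v₂) w z hu hu₂ huu₂ hv (by simpa using hv₂) (by simp [hvv₂]) hw hz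
  simp only [Matrix.mulVec_neg, dotProduct_neg] at hn
  nlinarith [sq_nonneg (u₂ ⬝ᵥ (p.2.1 *ᵥ v₂))]

/-- `|ᵗNu|² ≤ Q` as soon as `(uᵀNv)² ≤ Q` for all unit `v`. [folklore] -/
theorem normSq_transpose_mulVec_le_of_sq_le {N : Matrix (Fin 3) (Fin 3) ℝ} {u : Fin 3 → ℝ} {Q : ℝ}
    (h : ∀ v : Fin 3 → ℝ, v ⬝ᵥ v = 1 → (u ⬝ᵥ (N *ᵥ v)) ^ 2 ≤ Q) :
    (Nᵀ *ᵥ u) ⬝ᵥ (Nᵀ *ᵥ u) ≤ Q := by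
  have hQ : 0 ≤ Q := (sq_nonneg _).trans (h ![1, 0, 0] (by simp [dotProduct, Fin.sum_univ_three]))
  have h1 := normSq_mulTranspose_le_sq_of_bound (N := N) (u := u) (L := Q.sqrt) (Real.sqrt_nonneg _)
    fun v hv ↦ (le_abs_self _).trans (Real.abs_le_sqrt (h v hv))
  rwa [Real.sq_sqrt hQ] at h1

/-- **The bound on `|ᵗBu|²` used for block `A`**: under (1), `tr A = tr C`, `G ≥ 0` and `wᵀAw ≥ 0`,
`|ᵗBu|² ≤ G (wᵀAw) (tr A / 3)` for unit `u, w` (Hamilton: `b₃² ≤ G a₁c₁` and `c₁ ≤ c = a`; here with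
`c₁ ≤ c/3`). [cite: Hamilton1986, §7, pp. 171–172] -/
theorem SingularValuesSumSqLEMinProd.normSq_transpose_le {p : Blocks} {G : ℝ}
    (h : SingularValuesSumSqLEMinProd p G) (hG : 0 ≤ G) (htr : p.1.trace = p.2.2.trace)
    {u w : Fin 3 → ℝ} (hu : u ⬝ᵥ u = 1) (hw : w ⬝ᵥ w = 1) (hw0 : 0 ≤ w ⬝ᵥ (p.1 *ᵥ w)) :
    (p.2.1ᵀ *ᵥ u) ⬝ᵥ (p.2.1ᵀ *ᵥ u) ≤ G * (w ⬝ᵥ (p.1 *ᵥ w)) * (p.1.trace / 3) := by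
  obtain ⟨z₀, hz₀, hz₀le⟩ := exists_unit_rayleigh_le_trace_div_three p.2.2
  have h1 := normSq_transpose_mulVec_le_of_sq_le (N := p.2.1) (u := u) fun v hv ↦ h.sq_bilin_le hu hv hw hz₀
  refine h1.trans ?_
  rw [htr]
  exact mul_le_mul_of_nonneg_left hz₀le (mul_nonneg hG hw0)

/-- **The bound on `|Bu|²` used for block `C`** ("likewise"): under (1), `tr A = tr C`, `G ≥ 0` and
`wᵀCw ≥ 0`, `|Bu|² ≤ G (wᵀCw) (tr C / 3)` for unit `u, w`. [cite: Hamilton1986, §7, pp. 171–172] -/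
theorem SingularValuesSumSqLEMinProd.normSq_le {p : Blocks} {G : ℝ}
    (h : SingularValuesSumSqLEMinProd p G) (hG : 0 ≤ G) (htr : p.1.trace = p.2.2.trace)
    {u w : Fin 3 → ℝ} (hu : u ⬝ᵥ u = 1) (hw : w ⬝ᵥ w = 1) (hw0 : 0 ≤ w ⬝ᵥ (p.2.2 *ᵥ w)) :
    (p.2.1ᵀᵀ *ᵥ u) ⬝ᵥ (p.2.1ᵀᵀ *ᵥ u) ≤ G * (w ⬝ᵥ (p.2.2 *ᵥ w)) * (p.2.2.trace / 3) := by
  obtain ⟨z₀, hz₀, hz₀le⟩ := exists_unit_rayleigh_le_trace_div_three p.1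
  have h1 := normSq_transpose_mulVec_le_of_sq_le (N := p.2.1ᵀ) (u := u)
    (Q := G * (z₀ ⬝ᵥ (p.1 *ᵥ z₀)) * (w ⬝ᵥ (p.2.2 *ᵥ w))) fun v hv ↦ by
      rw [Matrix.dotProduct_transpose_mulVec]
      exact h.sq_bilin_le hv hu hz₀ hw
  refine h1.trans ?_
  rw [← htr]
  have h2 := mul_le_mul_of_nonneg_left hz₀le (mul_nonneg hG hw0)
  nlinarith [h2]

/-! ### The differential inequality at the extremal unit vectors (Hamilton 1986, pp. 171–172) -/

/-- The scalar bookkeeping: with `0 ≤ x ≤ a ≤ y` (`a₁, a₂, a₃`), `Nu ≤ G x y` (`|ᵗBu|²`),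
`Nw ≥ 0`, `G ≥ 0`, `H ≥ G + 1`, `x ≤ R` and `-1 < Hx - y ≤ 0`:
`(1 + (G + 2)R)(Hx - y) ≤ H(x² + Nw + 2ay) - (y² + Nu + 2xa)`. [cite: Hamilton1986, §7, pp. 171–172] -/
theorem pcoTwo_scalar {x a y Nu Nw G H R : ℝ} (hG : 0 ≤ G) (hH : G + 1 ≤ H) (hx : 0 ≤ x)
    (hxa : x ≤ a) (hay : a ≤ y) (hNu : Nu ≤ G * x * y) (hNw : 0 ≤ Nw) (hle : H * x - y ≤ 0)
    (hgt : -1 < H * x - y) (hxR : x ≤ R) :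
    (1 + (G + 2) * R) * (H * x - y) ≤ H * (x ^ 2 + Nw + 2 * (a * y)) - (y ^ 2 + Nu + 2 * (x * a)) := by
  have hH0 : 0 ≤ H := by linarith
  have hy : 0 ≤ y := by linarith
  -- reduce to `Φ = Hx² + 2Hxy - y² - (G + 2)xy`
  have h1 : 2 * (x * y) ≤ 2 * (a * y) := by nlinarith
  have h2 : 2 * (x * a) ≤ 2 * (x * y) := by nlinarith
  have hΦ : H * x ^ 2 + 2 * H * (x * y) - y ^ 2 - (G + 2) * (x * y) ≤
      H * (x ^ 2 + Nw + 2 * (a * y)) - (y ^ 2 + Nu + 2 * (x * a)) := by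
    nlinarith [mul_le_mul_of_nonneg_left h1 hH0]
  refine le_trans ?_ hΦ
  -- write `y = Hx + ε`, `0 ≤ ε < 1`
  set ε := y - H * x with hε
  have hε0 : 0 ≤ ε := by linarith
  have hε1 : ε ≤ 1 := by linarith
  have hy' : y = H * x + ε := by rw [hε]; ring
  have hmain : H * x ^ 2 + 2 * H * (x * y) - y ^ 2 - (G + 2) * (x * y) =
      H * x ^ 2 * (H - G - 1) - ε ^ 2 - (G + 2) * x * ε := by rw [hy']; ring
  rw [hmain]
  have h3 : 0 ≤ H * x ^ 2 * (H - G - 1) := mul_nonneg (by positivity) (by linarith)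
  have h4 : ε ^ 2 ≤ ε := by nlinarith
  have h5 : (G + 2) * x * ε ≤ (G + 2) * R * ε :=
    mul_le_mul_of_nonneg_right (mul_le_mul_of_nonneg_left hxR (by linarith)) hε0
  have h6 : (1 + (G + 2) * R) * (H * x - y) = -ε - (G + 2) * R * ε := by rw [hε]; ring
  rw [h6]
  linarith

variable {M N : Matrix (Fin 3) (Fin 3) ℝ}

/-- **Hamilton 1986, Thm. 7.1 (2): the differential inequality at the extremal unit vectors.**
Let `M` be symmetric with `a₁ ≥ m > 0`, let `|ᵗNu|² ≤ G (wᵀMw)(tr M / 3)` (the consequence of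
(1) and `tr A = tr C`), `0 < G`, `G + 1 ≤ H`, `Σ|M| ≤ R`, and let `w` minimise and `u` maximise the
Rayleigh quotient over unit vectors with `-1 < H wᵀMw - uᵀMu ≤ 0`. Then
`(1 + (G + 2)R)(H wᵀMw - uᵀMu) ≤ H wᵀM'w - uᵀM'u` for `M' = M² + NᵗN + 2M#`
(Lemma 6.1: `a₁' = a₁² + b₁'² + 2a₂a₃`, `a₃' = a₃² + b₃'² + 2a₁a₂` in the eigenbasis).
[cite: Hamilton1986, §6, Lemma 6.1 (p. 167); §7, Lemma 7.2, pp. 171–172] -/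
theorem pcoTwo_deriv (hM : M.IsSymm) {m G H R : ℝ} (hm : 0 < m) (hG : 0 < G) (hH : G + 1 ≤ H)
    (h1 : M.SmallestEigenvalueAddNonneg (-m)) (hR : ∑ k, ∑ l, |M k l| ≤ R)
    {u w : Fin 3 → ℝ} (hu : u ⬝ᵥ u = 1) (hw : w ⬝ᵥ w = 1)
    (hmax : ∀ z ∈ unitSet, z ⬝ᵥ (M *ᵥ z) ≤ u ⬝ᵥ (M *ᵥ u))
    (hmin : ∀ z ∈ unitSet, w ⬝ᵥ (M *ᵥ w) ≤ z ⬝ᵥ (M *ᵥ z))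
    (hNu : (Nᵀ *ᵥ u) ⬝ᵥ (Nᵀ *ᵥ u) ≤ G * (w ⬝ᵥ (M *ᵥ w)) * (M.trace / 3))
    (hle : H * (w ⬝ᵥ (M *ᵥ w)) - u ⬝ᵥ (M *ᵥ u) ≤ 0)
    (hgt : -1 < H * (w ⬝ᵥ (M *ᵥ w)) - u ⬝ᵥ (M *ᵥ u)) :
    (1 + (G + 2) * R) * (H * (w ⬝ᵥ (M *ᵥ w)) - u ⬝ᵥ (M *ᵥ u)) ≤
      H * (w ⬝ᵥ ((M * M + N * Nᵀ + (2 : ℝ) • M.sharp) *ᵥ w)) -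
        u ⬝ᵥ ((M * M + N * Nᵀ + (2 : ℝ) • M.sharp) *ᵥ u) := by
  have hu0 : ∀ z : Fin 3 → ℝ, z ⬝ᵥ u = 0 → u ⬝ᵥ (M *ᵥ z) = 0 :=
    fun z hz ↦ cross_eq_zero_of_max hM hu hmax hz
  have hw0 : ∀ z : Fin 3 → ℝ, z ⬝ᵥ w = 0 → w ⬝ᵥ (M *ᵥ z) = 0 :=
    fun z hz ↦ cross_eq_zero_of_min hM hw hmin hz
  -- `x = a₁ ≥ m > 0` and `y = a₃ ≥ Hx ≥ (G + 1)x > x`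
  have hx : m ≤ w ⬝ᵥ (M *ᵥ w) := by linarith [h1 w hw]
  have hxpos : 0 < w ⬝ᵥ (M *ᵥ w) := by linarith
  have hlt : w ⬝ᵥ (M *ᵥ w) < u ⬝ᵥ (M *ᵥ u) := by nlinarith
  -- `u ⊥ w`, eigenbasis `(w, n, u)` with `n = w × u`
  have huw : u ⬝ᵥ w = 0 := dot_eq_zero_of_eigen hM hu hw hu0 hw0 hlt.ne
  have hwu : w ⬝ᵥ u = 0 := by rw [dotProduct_comm]; exact huw
  set n := w ⨯₃ u with hn
  have hn1 : n ⬝ᵥ n = 1 := dotProduct_cross_self_of_orthonormal hw hu hwu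
  have hwn : w ⬝ᵥ n = 0 := dot_self_cross w u
  have hun : u ⬝ᵥ n = 0 := dot_cross_self w u
  have hnw : n ⬝ᵥ w = 0 := by rw [dotProduct_comm]; exact hwn
  have hnu : n ⬝ᵥ u = 0 := by rw [dotProduct_comm]; exact hun
  have cwn : w ⬝ᵥ (M *ᵥ n) = 0 := hw0 n hnw
  have cwu : w ⬝ᵥ (M *ᵥ u) = 0 := hw0 u huw
  have cnu : n ⬝ᵥ (M *ᵥ u) = 0 := by rw [quad_comm_of_isSymm hM]; exact hu0 n hnu
  have cnw : n ⬝ᵥ (M *ᵥ w) = 0 := by rw [quad_comm_of_isSymm hM]; exact cwn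
  have cuw : u ⬝ᵥ (M *ᵥ w) = 0 := by rw [quad_comm_of_isSymm hM]; exact cwu
  have Eu := quad_field_eq_of_diag (N := N) hM hw hn1 hu hwn hwu hnu cwn cwu cnu
  have Ew := quad_field_eq_of_diag (N := N) hM hn1 hu hw hnu hnw huw cnu cnw cuw
  rw [Eu, Ew]
  -- the scalars `x ≤ a ≤ y`, `tr M = x + a + y ≤ 3y`
  have ha2x : w ⬝ᵥ (M *ᵥ w) ≤ n ⬝ᵥ (M *ᵥ n) := hmin n hn1
  have ha2y : n ⬝ᵥ (M *ᵥ n) ≤ u ⬝ᵥ (M *ᵥ u) := hmax n hn1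
  have htr : w ⬝ᵥ (M *ᵥ w) + n ⬝ᵥ (M *ᵥ n) + u ⬝ᵥ (M *ᵥ u) = M.trace :=
    sum_quadratic_eq_trace_of_orthonormal M hw hn1 hu hwn hwu hnu
  have hNu' : (Nᵀ *ᵥ u) ⬝ᵥ (Nᵀ *ᵥ u) ≤ G * (w ⬝ᵥ (M *ᵥ w)) * (u ⬝ᵥ (M *ᵥ u)) := by
    refine hNu.trans (mul_le_mul_of_nonneg_left ?_ (mul_nonneg hG.le hxpos.le))
    rw [← htr]; linarith
  have hNw : 0 ≤ (Nᵀ *ᵥ w) ⬝ᵥ (Nᵀ *ᵥ w) := Finset.sum_nonneg fun i _ ↦ mul_self_nonneg _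
  have hxR : w ⬝ᵥ (M *ᵥ w) ≤ R := ((abs_le.1 (abs_quad_le_sum M hw)).2).trans hR
  exact pcoTwo_scalar hG.le hH hxpos.le ha2x ha2y hNu' hNw hle hgt hxR

/-- **The sign condition at a minimiser of `𝒢 = H wᵀMw - uᵀMu`** (`largestG H 0`): with the data
of `pcoTwo_deriv` for all unit `u, w`, at a minimiser with `-1 < 𝒢 ≤ 0`,
`(1 + (G + 2)R) 𝒢 ≤ 𝒢'`. [cite: Hamilton1986, §7, pp. 171–172] -/
theorem pcoTwo_sign (hM : M.IsSymm) {m G H R : ℝ} (hm : 0 < m) (hG : 0 < G) (hH : G + 1 ≤ H)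
    (h1 : M.SmallestEigenvalueAddNonneg (-m)) (hR : ∑ k, ∑ l, |M k l| ≤ R)
    (hNB : ∀ u w : Fin 3 → ℝ, u ⬝ᵥ u = 1 → w ⬝ᵥ w = 1 →
      (Nᵀ *ᵥ u) ⬝ᵥ (Nᵀ *ᵥ u) ≤ G * (w ⬝ᵥ (M *ᵥ w)) * (M.trace / 3))
    {q : UU} (hq : q ∈ (unitSet ×ˢ unitSet : Set UU))
    (hqmin : IsMinOn (largestG H 0 M) (unitSet ×ˢ unitSet) q) (hgt : -1 < largestG H 0 M q)
    (hle : largestG H 0 M q ≤ 0) :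
    (1 + (G + 2) * R) * largestG H 0 M q ≤ largestG H 0 (M * M + N * Nᵀ + (2 : ℝ) • M.sharp) q := by
  have hH0 : 0 < H := by linarith
  have hmin := rayleigh_min_of_isMinOn_largestG hH0 hq hqmin
  have hmax := rayleigh_max_of_isMinOn_largestG hq hqmin
  have hgt' : -1 < H * (q.2 ⬝ᵥ (M *ᵥ q.2)) - q.1 ⬝ᵥ (M *ᵥ q.1) := by simpa [largestG] using hgt
  have hle' : H * (q.2 ⬝ᵥ (M *ᵥ q.2)) - q.1 ⬝ᵥ (M *ᵥ q.1) ≤ 0 := by simpa [largestG] using hle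
  have h := pcoTwo_deriv (N := N) hM hm hG hH h1 hR hq.1 hq.2 hmax hmin (hNB q.1 q.2 hq.1 hq.2) hle' hgt'
  simpa [largestG] using h

/-! ### Thm. 7.1 (2), ODE part -/

section

variable (G H : ℝ)

/-- The abstract step: the barrier lemma for `largestG H 0` along a matrix curve `M` with
field-shaped derivative `M' = M² + NᵗN + 2M#`, under `a₁ ≥ m` and the bound on `|ᵗNu|²`.
[cite: Hamilton1986, §7, Thm. 7.1 (2) (pp. 170–172)] -/
theorem pcoTwo_preserved {M N M' : ℝ → Matrix (Fin 3) (Fin 3) ℝ} {t₀ t₁ m : ℝ}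
    (h₁ : t₀ ≤ t₁) (hm : 0 < m) (hG : 0 < G) (hH : G + 1 ≤ H)
    (hMc : ContinuousOn M (Icc t₀ t₁)) (hM'c : ContinuousOn M' (Icc t₀ t₁))
    (hM'eq : ∀ s ∈ Icc t₀ t₁, M' s = M s * M s + N s * (N s)ᵀ + (2 : ℝ) • (M s).sharp)
    (hderiv : ∀ s ∈ Icc t₀ t₁, ∀ k l, _root_.HasDerivAt (fun t ↦ M t k l) (M' s k l) s)
    (hsymm : ∀ s ∈ Icc t₀ t₁, (M s).IsSymm)
    (h1 : ∀ s ∈ Icc t₀ t₁, (M s).SmallestEigenvalueAddNonneg (-m))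
    (hNB : ∀ s ∈ Ico t₀ t₁, ∀ u w : Fin 3 → ℝ, u ⬝ᵥ u = 1 → w ⬝ᵥ w = 1 →
      ((N s)ᵀ *ᵥ u) ⬝ᵥ ((N s)ᵀ *ᵥ u) ≤ G * (w ⬝ᵥ (M s *ᵥ w)) * ((M s).trace / 3))
    (h0 : (M t₀).LargestLESmallestAdd H 0) : (M t₁).LargestLESmallestAdd H 0 := by
  have hK : IsCompact (unitSet ×ˢ unitSet : Set UU) := isCompact_unitSet.prod isCompact_unitSet
  have hKne : (unitSet ×ˢ unitSet : Set UU).Nonempty := unitSet_nonempty.prod unitSet_nonempty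
  have hGc := continuousOn_largestG H 0 hMc (unitSet ×ˢ unitSet)
  have hG'c := continuousOn_largestG H 0 hM'c (unitSet ×ˢ unitSet)
  have hGd : ∀ q ∈ (unitSet ×ˢ unitSet : Set UU), ∀ s ∈ Icc t₀ t₁,
      _root_.HasDerivAt (fun t ↦ largestG H 0 (M t) q) (largestG H 0 (M' s) q) s :=
    fun q _ s hs ↦ hasDerivAt_largestG H 0 (hderiv s hs) q
  -- uniform bound `R` for `Σ|M|`
  have hScont : ContinuousOn (fun t ↦ ∑ k, ∑ l, |M t k l|) (Icc t₀ t₁) :=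
    continuousOn_finsetSum _ fun k _ ↦ continuousOn_finsetSum _ fun l _ ↦
      ((continuousOn_pi.1 (continuousOn_pi.1 hMc k) l)).abs
  obtain ⟨sR, -, hR⟩ := isCompact_Icc.exists_isMaxOn (nonempty_Icc.2 h₁) hScont
  set R := ∑ k, ∑ l, |M sR k l| with hRdef
  have hR' : ∀ s ∈ Icc t₀ t₁, ∑ k, ∑ l, |M s k l| ≤ R := fun s hs ↦ hR hs
  have hR0 : 0 ≤ R := Finset.sum_nonneg fun k _ ↦ Finset.sum_nonneg fun l _ ↦ abs_nonneg _
  have hC0 : 0 ≤ 1 + (G + 2) * R := by positivity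
  have key := minOverSet_nonneg_of_deriv (G := fun t q ↦ largestG H 0 (M t) q)
    (G' := fun t q ↦ largestG H 0 (M' t) q) hK hKne hGc hGd hG'c h₁ one_pos hC0 (η := 1)
    (fun s hs q hq hqmin hgt hle ↦ ?_) ?_
  · rw [largestLESmallestAdd_iff]
    exact (le_minOverSet_iff hK hKne (continuousOn_slice (G := fun t q ↦ largestG H 0 (M t) q)
      hGc (right_mem_Icc.2 h₁)) 0).1 key
  · have hsI : s ∈ Icc t₀ t₁ := Ico_subset_Icc_self hs
    have h := pcoTwo_sign (N := N s) (hsymm s hsI) hm hG hH (h1 s hsI) (hR' s hsI) (hNB s hs)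
      hq hqmin hgt hle
    simpa only [hM'eq s hsI] using h
  · refine (le_minOverSet_iff hK hKne (continuousOn_slice (G := fun t q ↦ largestG H 0 (M t) q)
      hGc (left_mem_Icc.2 h₁)) 0).2 ?_
    exact (largestLESmallestAdd_iff H 0 (M t₀)).1 h0

end

/-- **Hamilton 1986, Thm. 7.1 (2), ODE part, block `A` (proved)**: `{a₃ ≤ H a₁}` is forward
invariant relative to `{A, C symmetric} ∩ {tr A = tr C} ∩ {a₁ ≥ m} ∩ {c₁ ≥ m} ∩ {(b₂ + b₃)² ≤ G a₁c₁}`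
for `0 < m`, `0 < G`, `G + 1 ≤ H`. [cite: Hamilton1986, §7, Thm. 7.1 (2) (pp. 170–172)] -/
theorem isInvariantRel_pcoTwo_fst {m G H : ℝ} (hm : 0 < m) (hG : 0 < G) (hH : G + 1 ≤ H) :
    IsInvariantRel field
      (fun _ ↦ {p : Blocks | (p.1.IsSymm ∧ p.2.2.IsSymm) ∧ p.1.trace = p.2.2.trace ∧
        p.1.SmallestEigenvalueAddNonneg (-m) ∧ p.2.2.SmallestEigenvalueAddNonneg (-m) ∧
        SingularValuesSumSqLEMinProd p G})
      (fun _ ↦ {p | p.1.LargestLESmallestAdd H 0}) := by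
  intro γ t₀ t₁ _ h₁ hγ hK hin
  have hγc := IsSolutionOn.continuousOn hγ
  refine pcoTwo_preserved G H (M := fun s ↦ (γ s).1) (N := fun s ↦ (γ s).2.1)
    (M' := fun s ↦ (field (γ s)).1) h₁ hm hG hH (continuousOn_fst.comp hγc (mapsTo_univ _ _))
    (continuousOn_fst.comp (continuous_field.comp_continuousOn hγc) (mapsTo_univ _ _))
    (fun s _ ↦ rfl) (fun s hs k l ↦ (hγ s hs).1 k l) (fun s hs ↦ (hK s hs).1.1)
    (fun s hs ↦ (hK s hs).2.2.1) (fun s hs u w hu hw ↦ ?_) hin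
  obtain ⟨-, htr, h1A, -, hone⟩ := hK s (Ico_subset_Icc_self hs)
  exact hone.normSq_transpose_le hG.le htr hu hw (by linarith [h1A w hw])

/-- **Hamilton 1986, Thm. 7.1 (2), ODE part, block `C` (proved)** ("and likewise `c₃ ≤ H c₁`").
[cite: Hamilton1986, §7, Thm. 7.1 (2) (pp. 170–172)] -/
theorem isInvariantRel_pcoTwo_snd {m G H : ℝ} (hm : 0 < m) (hG : 0 < G) (hH : G + 1 ≤ H) :
    IsInvariantRel field
      (fun _ ↦ {p : Blocks | (p.1.IsSymm ∧ p.2.2.IsSymm) ∧ p.1.trace = p.2.2.trace ∧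
        p.1.SmallestEigenvalueAddNonneg (-m) ∧ p.2.2.SmallestEigenvalueAddNonneg (-m) ∧
        SingularValuesSumSqLEMinProd p G})
      (fun _ ↦ {p | p.2.2.LargestLESmallestAdd H 0}) := by
  intro γ t₀ t₁ _ h₁ hγ hK hin
  have hγc := IsSolutionOn.continuousOn hγ
  refine pcoTwo_preserved G H (M := fun s ↦ (γ s).2.2) (N := fun s ↦ (γ s).2.1ᵀ)
    (M' := fun s ↦ (field (γ s)).2.2) h₁ hm hG hH
    ((continuousOn_snd.comp continuousOn_snd (mapsTo_univ _ _)).comp hγc (mapsTo_univ _ _))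
    ((continuousOn_snd.comp continuousOn_snd (mapsTo_univ _ _)).comp
      (continuous_field.comp_continuousOn hγc) (mapsTo_univ _ _))
    (fun s _ ↦ field_snd_snd (γ s)) (fun s hs k l ↦ (hγ s hs).2.2 k l) (fun s hs ↦ (hK s hs).1.2)
    (fun s hs ↦ (hK s hs).2.2.2.1) (fun s hs u w hu hw ↦ ?_) hin
  obtain ⟨-, htr, -, h1C, hone⟩ := hK s (Ico_subset_Icc_self hs)
  exact hone.normSq_le hG.le htr hu hw (by linarith [h1C w hw])

/-- **Hamilton 1986, Thm. 7.1, inequality (2), ODE part (proved)**: for `0 < m`, `0 < G` and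
`G + 1 ≤ H`, `{a₃ ≤ H a₁} ∩ {c₃ ≤ H c₁}` is forward invariant under Hamilton's ODE `M' = M² + M#`
relative to `{A, C symmetric} ∩ {tr A = tr C} ∩ {a₁ ≥ m} ∩ {c₁ ≥ m} ∩ {(b₂ + b₃)² ≤ G a₁c₁}`
("Thus the inequalities `a₃ ≤ Ha₁` and likewise `c₃ ≤ Hc₁` are preserved", p. 172).
[cite: Hamilton1986, §7, Thm. 7.1 (2) (pp. 170–172)] -/
theorem hamilton1986_pinchingTwo_ode : ∀ m G H : ℝ, 0 < m → 0 < G → G + 1 ≤ H →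
    IsInvariantRel field
      (fun _ ↦ {p : Blocks | (p.1.IsSymm ∧ p.2.2.IsSymm) ∧ p.1.trace = p.2.2.trace ∧
        p.1.SmallestEigenvalueAddNonneg (-m) ∧ p.2.2.SmallestEigenvalueAddNonneg (-m) ∧
        SingularValuesSumSqLEMinProd p G})
      (fun _ ↦ {p | p.1.LargestLESmallestAdd H 0 ∧ p.2.2.LargestLESmallestAdd H 0}) :=
  fun _ _ _ hm hG hH ↦ (isInvariantRel_pcoTwo_fst hm hG hH).inter (isInvariantRel_pcoTwo_snd hm hG hH)

/-- **Hamilton 1986, Thm. 7.1 (2), relative to `M ≥ m > 0`** (with `tr A = tr C` and (1)) — the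
form used in the pinching set. [cite: Hamilton1986, §7, Thm. 7.1 (2) (pp. 170–172)] -/
theorem hamilton1986_pinchingTwo_ode_of_operatorGE {m G H : ℝ} (hm : 0 < m) (hG : 0 < G)
    (hH : G + 1 ≤ H) :
    IsInvariantRel field
      (fun _ ↦ {p : Blocks | (p.1.IsSymm ∧ p.2.2.IsSymm) ∧ p.1.trace = p.2.2.trace ∧
        OperatorGE p m ∧ SingularValuesSumSqLEMinProd p G})
      (fun _ ↦ {p | p.1.LargestLESmallestAdd H 0 ∧ p.2.2.LargestLESmallestAdd H 0}) :=
  (hamilton1986_pinchingTwo_ode m G H hm hG hH).mono_left fun _ _ _ hp ↦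
    ⟨hp.1, hp.2.1, hp.2.2.1.smallestEigenvalueAddNonneg_fst,
      hp.2.2.1.smallestEigenvalueAddNonneg_snd_snd, hp.2.2.2⟩

/-! ### The first two groups of Thm. 7.1 together: an invariant closed convex set -/

/-- **The set cut out by the first two groups of inequalities of Hamilton's Thm. 7.1** on
`{M ≥ m}` (with the standing constraints `A, C` symmetric and `tr A = tr C`):
`Z₂(m, G, H) = {A, C symmetric} ∩ {tr A = tr C} ∩ {M ≥ m} ∩ {(b₂ + b₃)² ≤ G a₁c₁} ∩ {a₃ ≤ H a₁} ∩ {c₃ ≤ H c₁}`.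
[cite: Hamilton1986, §7, Thm. 7.1 (1), (2) (p. 170)] -/
def pcoPinchingTwo (m G H : ℝ) : Set Blocks :=
  {p | (p.1.IsSymm ∧ p.2.2.IsSymm) ∧ p.1.trace = p.2.2.trace ∧ OperatorGE p m ∧
    SingularValuesSumSqLEMinProd p G ∧ p.1.LargestLESmallestAdd H 0 ∧ p.2.2.LargestLESmallestAdd H 0}

/-- **`Z₂(m, G, H)` is forward invariant under Hamilton's ODE** for `0 < m`, `0 < G`, `G + 1 ≤ H`
("the sets defined by each successive group of inequalities is preserved", p. 171: `M ≥ m`,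
symmetry and `tr A = tr C` are preserved; then (1); then (2) given (1)).
[cite: Hamilton1986, §7, Thm. 7.1 (1), (2) (pp. 170–172)] -/
theorem isInvariant_pcoPinchingTwo {m G H : ℝ} (hm : 0 < m) (hG : 0 < G) (hH : G + 1 ≤ H) :
    IsInvariant field (fun _ ↦ pcoPinchingTwo m G H) := by
  -- `Z₀ = {sym} ∩ {M ≥ m}`, then `∩ {tr A = tr C}`, then `∩ (1)`, then `∩ (2)`
  have h0 := isInvariant_isSymm_operatorGE hm.le
  have h0' : IsInvariant field (fun _ ↦ ({p : Blocks | p.1.IsSymm ∧ p.2.2.IsSymm} ∩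
      {p : Blocks | OperatorGE p m}) ∩ {p : Blocks | p.1.trace = p.2.2.trace}) :=
    h0.inter_rel_self (isInvariant_trace_eq.mono_left fun _ _ _ _ ↦ mem_univ _)
  have h1 := h0'.inter_rel (K := fun _ ↦ {p : Blocks | (p.1.IsSymm ∧ p.2.2.IsSymm) ∧ OperatorGE p m})
    (fun _ _ p hp ↦ ⟨hp.1.1, hp.1.2⟩) (hamilton1986_pinchingOne_ode_of_operatorGE hm hG)
  have h2 := h1.inter_rel (K := fun _ ↦ {p : Blocks | (p.1.IsSymm ∧ p.2.2.IsSymm) ∧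
      p.1.trace = p.2.2.trace ∧ OperatorGE p m ∧ SingularValuesSumSqLEMinProd p G})
    (fun _ _ p hp ↦ ⟨hp.1.1.1, hp.1.2, hp.1.1.2, hp.2⟩) (hamilton1986_pinchingTwo_ode_of_operatorGE hm hG hH)
  have e : (fun _ : ℝ ↦ (({p : Blocks | p.1.IsSymm ∧ p.2.2.IsSymm} ∩ {p : Blocks | OperatorGE p m}) ∩
      {p : Blocks | p.1.trace = p.2.2.trace}) ∩ {p | SingularValuesSumSqLEMinProd p G} ∩
      {p : Blocks | p.1.LargestLESmallestAdd H 0 ∧ p.2.2.LargestLESmallestAdd H 0}) =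
      fun _ ↦ pcoPinchingTwo m G H := by
    funext t; ext p
    simp only [pcoPinchingTwo, mem_inter_iff, mem_setOf_eq]
    tauto
  rw [e] at h2
  exact h2

/-- `Z₂(m, G, H)` is closed ("Clearly `Z` is closed", p. 170). [cite: Hamilton1986, §7, Thm. 7.1 (p. 170)] -/
theorem isClosed_pcoPinchingTwo (m G H : ℝ) : IsClosed (pcoPinchingTwo m G H) :=
  isClosed_isSymm.inter <| isClosed_trace_eq.inter <| (isClosed_operatorGE m).inter <|
    (isClosed_singularValuesSumSqLEMinProd G).inter <|
    (isClosed_largestLESmallestAddA H 0).inter (isClosed_largestLESmallestAddC H 0)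

/-- **(1) is convex on `{a₁ ≥ m, c₁ ≥ m}`, `m ≥ 0`, `G ≥ 0`**, chord form ("That `Z` is convex
follows from Lemma 6.3", p. 170: `b₂ + b₃` is convex, `a₁`, `c₁` are concave and positive, so
`√(a₁c₁)` is concave; here via the chord inequality `sq_combo_le` of the cone `y² ≤ Λxz`).
[cite: Hamilton1986, §7, Thm. 7.1 (p. 170); §6, p. 167 and Lemma 6.3 (p. 170)] -/
theorem SingularValuesSumSqLEMinProd.combo {x y : Blocks} {m G a b : ℝ} (hm : 0 ≤ m) (hG : 0 ≤ G)
    (hxA : x.1.SmallestEigenvalueAddNonneg (-m)) (hxC : x.2.2.SmallestEigenvalueAddNonneg (-m))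
    (hyA : y.1.SmallestEigenvalueAddNonneg (-m)) (hyC : y.2.2.SmallestEigenvalueAddNonneg (-m))
    (hx : SingularValuesSumSqLEMinProd x G) (hy : SingularValuesSumSqLEMinProd y G)
    (ha : 0 ≤ a) (hb : 0 ≤ b) : SingularValuesSumSqLEMinProd (a • x + b • y) G := by
  intro u₁ u₂ v₁ v₂ w z hu₁ hu₂ hu hv₁ hv₂ hv hw hz
  simp only [combo_fst, combo_snd_fst, combo_snd_snd]
  rw [two_quad_combo, quad_combo, quad_combo]
  exact sq_combo_le ha hb hG (by linarith [hxA w hw]) (by linarith [hyA w hw])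
    (by linarith [hxC z hz]) (by linarith [hyC z hz])
    (hx u₁ u₂ v₁ v₂ w z hu₁ hu₂ hu hv₁ hv₂ hv hw hz) (hy u₁ u₂ v₁ v₂ w z hu₁ hu₂ hu hv₁ hv₂ hv hw hz)

/-- **`Z₂(m, G, H)` is convex** for `m ≥ 0`, `G ≥ 0` ("That `Z` is convex follows from Lemma 6.3",
p. 170; `{a₃ ≤ H a₁}` is even cut out by linear inequalities in the present variational form).
[cite: Hamilton1986, §7, Thm. 7.1 (p. 170)] -/
theorem convex_pcoPinchingTwo {m G : ℝ} (hm : 0 ≤ m) (hG : 0 ≤ G) (H : ℝ) :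
    Convex ℝ (pcoPinchingTwo m G H) := by
  rintro x ⟨hxs, hxt, hxo, hx1, hx2A, hx2C⟩ y ⟨hys, hyt, hyo, hy1, hy2A, hy2C⟩ a b ha hb hab
  refine ⟨isSymm_combo hxs hys a b, trace_eq_combo hxt hyt a b, hxo.combo hyo ha hb hab,
    SingularValuesSumSqLEMinProd.combo hm hG hxo.smallestEigenvalueAddNonneg_fst
      hxo.smallestEigenvalueAddNonneg_snd_snd hyo.smallestEigenvalueAddNonneg_fst
      hyo.smallestEigenvalueAddNonneg_snd_snd hx1 hy1 ha hb, ?_, ?_⟩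
  · simpa only [combo_fst] using hx2A.combo hy2A ha hb hab
  · simpa only [combo_snd_snd] using hx2C.combo hy2C ha hb hab

/-- **`Z₂(m, G, H)` is symmetric under `B ↦ -B`** (it depends on `B` only through `M(v, v)` up to
`v ↦ (v₁, -v₂)` and the Ky Fan sums up to the sign of a frame), so it can be fed to
`hamilton_maximumPrinciple_curvatureODE` in either sign convention of the `B^#` term.
[folklore] -/
theorem reflectB_mem_pcoPinchingTwo {m G H : ℝ} {p : Blocks} (h : p ∈ pcoPinchingTwo m G H) :
    reflectB p ∈ pcoPinchingTwo m G H := by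
  obtain ⟨hs, ht, ho, h1, h2A, h2C⟩ := h
  exact ⟨hs, ht, ho.reflectB, h1.reflectB, h2A, h2C⟩

end HamiltonODE

end Literature.Geometry.Riemannian

end
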